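import Literature.MathematicalPhysics.QuantumFieldTheory.Balaban1983to89.T4CouplingAnalyticity
import Summits.QuantumFields.BalabanUV.T4Continuum.Spine.NE4.FadingFromRate
import Summits.QuantumFields.BalabanUV.T4Continuum.Spine.NE9.TowerCarriers

/-!
# BalabanUVNodes ∕ N22 knit — node N22 = spine estimate NE9, statement of record `T4OutputRate.NE9 E W κ Λ ∧ FadingMemory C₉ ω Λ`
# BY NAME on the abstract output carriers, DERIVED from OSCILLATION FADING (= tower-NE5, node N18 at every pair of run lengths)
# + C^{1,1} REGULARITY in each young coupling + the printed prefix dependence, by Landau–Kolmogorov interpolation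
# (Track A, DAG node N22; cluster K4 «SpineRates»; KNIT-BY-NAME seat `pub-ymgap-dag-n22-a`)

HONEST FRAMING.  Count-neutral kernel bookkeeping over LANDED hypothesis shapes; NOT a node discharge (YM-PLAN §1: no NODE 00 stage pins
node U3's carriers; the one-step renormalization transformation W1 = [Balaban1988RG2Cluster] §2 (2.13)–(2.14) as a Lean object is instance
0∕1).  NE5 ∕ NE9 are NOT IN PRINT and NOT PROVED.  One finite four-torus programme ([Balaban1983to89], T⁴, SU(N)) at fixed ε; nothing
continuum ∕ ℝ⁴ ∕ OS ∕ mass-gap ∕ Clay.  0 `sorry`, 0 `def`, standard axioms.  Filed `--supports` item `SpineGivenEndpoint` of route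
«BalabanUVNodes» (director-ym LINE №12).

THE NODE.  Statement of record (YM-PLAN v0.12.15 §2c row NE9; BALABAN-GAPS v1.0 §C l.57; venue `N22_NE9.lean`; dagwriter K4 stub
`S_N22 RRec : RRec … R → N22At R.u3`, `N22At u := NE9 u.EA u.W u.κ u.Λ ∧ FadingMemory u.C₉ u.ω u.Λ`):
`Literature.….T4OutputRate.NE9 E W κ Λ` (T4OutputRate.lean :194) ∧ `T4OutputRate.FadingMemory C₉ ω Λ` (:202) — JOINT Lipschitz
dependence of the scale-`j` output term on the coupling history with moduli `Λ j i`, AND geometric decay of the moduli in the age `j − i`.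

THE KNIT.  The β-side twin of this pair (`T4CouplingMatching.HistLipschitz ∧ FadingMemory`, node U2) FOLLOWS from the η-rate NE4 plus
C^{1,1} regularity of `β_{k+1}` in each coupling (gaps seat ne4, `Spine/NE4/FadingFromRate.histLipschitz_fadingMemory_of_smooth`, by the
Landau–Kolmogorov interpolation `abs_deriv_le_of_osc`: an `O(θ^{age})` OSCILLATION and an `M`-Lipschitz DERIVATIVE force an `O(√θ^{age})`
Lipschitz CONSTANT).  On the E-side the gaps cell derived the OSCILLATION form of fading memory from «tower-NE5» (`T4OutputRate.NE5` =
node N18 for every pair of consecutive run lengths: `MemoryFromRate.osc_le_of_towerRate`, tower of carriers `TowerCarriers.TowerData` ∕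
`TowerNE5`) and recorded — as a remark only, `ne/NE9.md` §4 [v1.4] — that the LITERAL shape `FadingMemory` follows from it «plus
C^{1,1}-regularity per coupling by ne4's Landau–Kolmogorov lemma».  THIS FILE PROVES THAT REMARK and so concludes node N22's decl BY NAME
from in-edge interfaces that are tree constants:
* §1 `abs_sub_update_le_of_osc_smooth` — COORDINATEWISE FADING LIPSCHITZ CONSTANTS on the abstract carriers `C : T4OutputRate.Carriers`:
  (O) oscillation fading with constant `C₀`, rate `θ`, and (R) C^{1,1} sections with constant `M·e^{−κd(X)}` on `[0, γ]` give: changing the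
  coupling `g_i` (`i < j = scale X`) of an admissible history inside `]0, γ]` moves `E g U X` by at most
  `e^{−κd(X)}·C₁·τ^{j−1−i}·|Δg_i|`, `C₁ = 2C₀∕γ + Mγ∕2`, for every rate `τ ∈ ]0, 1]` with `θ ≤ τ²` (ne4's `abs_deriv_le_of_osc` ∕
  `abs_sub_le_of_deriv_bound` BY NAME, Landau step `h = (γ∕2)·τ^{j−1−i}`; the box dictionary `T4CouplingAnalyticity.update_mem_boxWindow`,
  `Window γ = BoxWindow ]0, γ]` by `rfl`).  GENERAL FORM `…_of_osc_growingSmooth`: the regularity constants may GROW with the age,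
  `M·μ^{j−1−i}·e^{−κd(X)}` (as the recursion's moduli do, `T4HistoryLipschitzRecursion`); with a Landau step ratio `ρ ∈ ]0, 1]`, `θ ≤ τρ`,
  `μρ ≤ τ` the same cost holds — FADING (`τ < 1`) is available iff `θμ < 1`, i.e. for ANY growth rate `μ < θ⁻¹` (the E-side smallness is
  relaxed from the recursion's clause N2 `ω + c < 1` to `μ < θ⁻¹`; rate `√(θμ)` at best).
* §2 `coordLipschitzOn_of_osc_growingSmooth` — the same as `T4CouplingAnalyticity.CoordLipschitzOn ]0, γ] E κ Λ₁` (pv10's typed missing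
  inequality (W5): coordinatewise Lipschitz dependence on each running coupling down to the vertex) with FADING moduli `Λ₁ k i = C₉·τ^{k−i}`,
  `C₉ = C₁∕τ`.
* §3 HEADLINE `ne9_and_fadingMemory_of_osc_smooth` (one regularity constant, `θ ≤ τ²`) and `…_of_osc_growingSmooth` (growing constants) —
  (P) ∧ (O) ∧ (R) ⟹ **`NE9 E (Window γ) κ Λ₁ ∧ FadingMemory C₉ τ Λ₁`**, node N22's statement of record BY NAME with the DECAY of the moduli
  derived: first conjunct by pv10's telescoping `T4CouplingAnalyticity.ne9_of_coordLipschitz` (switch the couplings one at a time inside the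
  box; prefix dependence above the scale), second by `fadingMemory_geometric`.  §3b `…_of_osc_derivTwo`: the C² form of (R)
  (`|∂²_i E| ≤ M·e^{−κd(X)}` on `[0, γ]`, `lipDeriv_of_derivTwo_bound`).
* §4 THE IN-EDGE N18 BY NAME: `oscFading_of_towerNE5` — on ne9's tower of carriers `T : TowerData` with level functionals `E k`,
  `TowerNE5 T E γ κ θ C₅` (= `T4OutputRate.NE5` at EVERY pair of consecutive run lengths with run B's unpaired coupling as a parameter —
  node N18's statement in the K4 family shape `N18At`, read along the tower) gives (O) for every `E k` on the level carriers `T.level k`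
  with `C₀ = 2C₅∕(1−θ)` (`extendTower_rate` + `osc_le_of_towerRate` BY NAME); `towerNE9_fadingMemory_of_towerNE5_smooth` — hence
  tower-NE5 ∧ (P) ∧ (R) at every level ⟹ `TowerNE9 T E γ κ Λ₁ ∧ FadingMemory C₉ τ Λ₁`: NODE N22 AT EVERY LEVEL OF THE TOWER from node
  N18's tower statement plus regularity, `C₉ = (4C₅∕((1−θ)γ) + Mγ∕2)∕τ`.

TWO ROADS TO N22 BY NAME (both count-neutral until NODE 00 pins node U3's carriers).  ROAD 1 = the END OF RECORD of the NE9 formalisation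
swarm: `Spine/NE9/LeafIndex.rootShape_of_leaves` ∕ `Spine/NE9/CarriersOfRecordFaces.rec_ne9_and_fadingMemory_of_couplingTwoPoint` conclude
`NE9 E W κ (prodModuli ℓ ·) ∧ FadingMemory (ℓ∕ω′) ω′ …` from the displayed binders L-S1 … L-N1 (the one-step cluster representation as data —
model O-NE9-1 — plus Kotecký–Preiss two-point control), with memory FADING iff `ω′ = ω + 4·lipbar·a₁·τ̄ < 1` (clause N2).  ROAD 2 = THIS
FILE: binders tower-NE5 (node N18 along the tower) + (P) + (R); NO clause N2 — fading iff `θμ < 1` (§1's general form), the contraction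
being the tower η-rate's (as `Spine/NE9/TowerRateRelocation` predicts: for a Markov step the tower rate and the E-side fading are the same
scalar).  The two roads share the wall: (R), like O-NE9-1, is supplied for Bałaban's `E^{(j)}` only by the one-step transformation W1.

THE HYPOTHESES, located (binders over ABSTRACT carriers; NOTHING of Bałaban's construction is modelled):
(P) `PrefixDependenceOn E (Window γ)` — PRINTED IN WORDS, [Balaban1987RG1] p. 256 *"The function E_k depends also on the effective coupling
constants g₀, …, g_{k−1}"*, p. 298.
(O) OSCILLATION FADING `∀ g g' ∈ Window γ, ∀ U X, ∀ a ≤ scale X, (∀ n ≥ a, g n = g' n) → |E g U X − E g' U X| ≤ C₀·θ^{scale X − a}·e^{−κd(X)}` —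
NOT PRINTED; = tower-NE5 (§4); print has only the uniformity in the lattice spacing, [Balaban1987RG1] Thm 1 p. 259 *"the above bound is
uniform in the lattice spacing ε"*; at `a = scale X` it is twice the printed decay bound (1.18) p. 263.
(R) COORDINATEWISE C^{1,1}: for `g ∈ Window γ`, `U`, `X`, `i < scale X` the section `t ↦ E (update g i t) U X` is differentiable within `[0, γ]`
with an `M·e^{−κd(X)}`-Lipschitz derivative — of the printed TYPE for the LAST coupling: [Balaban1987RG1] p. 263 *"It is a C^∞-function of
g_{j−1} ∈ [0, γ], (or analytic), with a positive, absolute γ"* (a BOUND on derivatives, uniform in `j` as (1.18) is); for the OLDER couplings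
print says only that the dependence exists (pp. 256, 298) — UNPRINTED there exactly as NE9 is (GAPS G-t4-U3-3), but a regularity BOUND, not a
decay statement (ne4's `Spine/NE4/FadingFromRate.CoordDerivLipschitz` is the β-side twin).  (R) cannot be dropped: `F = θ^m·sin(g₀∕θ^m)` has
oscillation `2θ^m` and Lipschitz constant `1` at every level (cf. ne4's `FadingNeedsRegularity`), so «fading moduli from ANY modulus + the
tower rate» is false as a bare implication; the regularity clause is what the ROSTER's «FadingMemory from any modulus» needs.

References (TYPES only): [Balaban1987RG1] = T. Bałaban, *Renormalization group approach to lattice gauge field theories. I*, Commun. Math.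
Phys. **109** (1987) 249–301 — p. 256, Thm 1 p. 259, (1.18) and the C^∞ clause p. 263, p. 298; [Balaban1988RG2Cluster] = T. Bałaban, *…
II*, Commun. Math. Phys. **116** (1988) 1–22, §2 (2.13)–(2.14); [King1986] = C. King, Commun. Math. Phys. **102** (1986) 649–677, (3.73)
p. 665 (the printed model of an η-rate).
-/

noncomputable section

namespace Summit.QuantumFields.YangMills.BalabanUVNodes.N22Knit

open Set
open scoped BigOperators
open Literature.MathematicalPhysics.QuantumFieldTheory.Balaban1983to89
open Literature.MathematicalPhysics.QuantumFieldTheory.Balaban1983to89.T4OutputRate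
open Literature.MathematicalPhysics.QuantumFieldTheory.Balaban1983to89.T4CouplingAnalyticity
  (BoxWindow CoordLipschitzOn update_mem_boxWindow ne9_of_coordLipschitz)
open Summit.QuantumFields.BalabanUV.T4Continuum.Spine.NE4 (abs_deriv_le_of_osc abs_sub_le_of_deriv_bound)
open Summit.QuantumFields.BalabanUV.T4Continuum.NE9.MemoryFromRate (osc_le_of_towerRate shift_mem_window)
open Summit.QuantumFields.BalabanUV.T4Continuum.NE9.TowerCarriers
  (TowerData TowerNE5 TowerNE9 extendTower extendTower_rate extendTower_of_le rate_of_towerNE5)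

section Abstract

variable {C : Carriers} {Bg : Type} {E : Functional C Bg}

/-! ## §1 Coordinatewise fading Lipschitz constants from oscillation fading + C^{1,1} regularity (constants may GROW with the age) -/

/-- **COORDINATEWISE FADING LIPSCHITZ CONSTANTS — GROWING REGULARITY CONSTANTS ALLOWED.**  Under (O) oscillation fading with constant
`C₀ ≥ 0` and rate `θ ≥ 0`, and (R_μ) C^{1,1} regularity of the section in the coupling `g_i` with the AGE-DEPENDENT constant
`M·μ^{scale X − 1 − i}·e^{−κd(X)}` (`M, μ ≥ 0`; `μ = 1` = one uniform constant; `μ > 1` = the regularity inherited through the recursion may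
DEGRADE geometrically with the age, as the moduli of `T4HistoryLipschitzRecursion` do) on `[0, γ]` (`γ > 0`): for every Landau step ratio
`ρ ∈ ]0, 1]` and rate `τ` with `θ ≤ τρ` and `μρ ≤ τ`, changing `g_i` (`i < scale X`) of an admissible history inside `]0, γ]` moves the term
by at most `e^{−κd(X)}·(2C₀∕γ + Mγ∕2)·τ^{scale X − 1 − i}·|t − g_i|` (the two histories agree at every index `≥ i + 1`, so (O) caps the
oscillation of the section by `C₀θ^{a}e^{−κd(X)}`, `a = scale X − 1 − i`; ne4's Landau–Kolmogorov lemma `abs_deriv_le_of_osc` with the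
step `h = (γ∕2)·ρ^{a}` gives `|∂_i E| ≤ e^{−κd(X)}·((2C₀∕γ)(θ∕ρ)^a + (Mγ∕2)(μρ)^a)`).  Admissible `(ρ, τ)` exist iff `θμ ≤ τ² ≤ μ²`:
the fading rate is `√(θμ)` at best — any growth rate `μ < θ⁻¹` of the regularity constants still gives FADING moduli. [folklore] -/
theorem abs_sub_update_le_of_osc_growingSmooth {γ κ C₀ θ M μ ρ τ : ℝ}
    (hO : ∀ g ∈ Window γ, ∀ g' ∈ Window γ, ∀ (U : Bg) (X : C.Dom) (a : ℕ), a ≤ C.scale X →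
      (∀ n, a ≤ n → g n = g' n) → |E g U X - E g' U X| ≤ C₀ * θ ^ (C.scale X - a) * Real.exp (-(κ * C.d X)))
    (hR : ∀ g ∈ Window γ, ∀ (U : Bg) (X : C.Dom) (i : ℕ), i < C.scale X → ∃ f' : ℝ → ℝ,
      (∀ t ∈ Icc (0 : ℝ) γ, HasDerivWithinAt (fun t : ℝ => E (Function.update g i t) U X) (f' t) (Icc (0 : ℝ) γ) t) ∧
      ∀ s ∈ Icc (0 : ℝ) γ, ∀ t ∈ Icc (0 : ℝ) γ,
        |f' s - f' t| ≤ M * μ ^ (C.scale X - 1 - i) * Real.exp (-(κ * C.d X)) * |s - t|)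
    (hC₀ : 0 ≤ C₀) (hθ0 : 0 ≤ θ) (hM : 0 ≤ M) (hμ : 0 ≤ μ) (hγ : 0 < γ) (hρ0 : 0 < ρ) (hρ1 : ρ ≤ 1)
    (hθτρ : θ ≤ τ * ρ) (hμρτ : μ * ρ ≤ τ)
    {g : ℕ → ℝ} (hg : g ∈ Window γ) (U : Bg) (X : C.Dom) {i : ℕ} (hi : i < C.scale X) {t : ℝ}
    (ht : t ∈ Ioc (0 : ℝ) γ) :
    |E (Function.update g i t) U X - E g U X| ≤
      Real.exp (-(κ * C.d X)) * ((2 * C₀ / γ + M * γ / 2) * τ ^ (C.scale X - 1 - i)) * |t - g i| := by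
  obtain ⟨f', hf', hLip⟩ := hR g hg U X i hi
  set a : ℕ := C.scale X - 1 - i with ha
  set w : ℝ := Real.exp (-(κ * C.d X)) with hw
  have hw0 : 0 < w := Real.exp_pos _
  -- oscillation of the section `t ↦ E (update g i t) U X` on `]0, γ]`
  have hosc : ∀ x ∈ Ioc (0 : ℝ) γ, ∀ y ∈ Ioc (0 : ℝ) γ,
      |E (Function.update g i x) U X - E (Function.update g i y) U X| ≤ C₀ * θ ^ a * w := by
    intro x hx y hy
    have hagree : ∀ n, i + 1 ≤ n → Function.update g i x n = Function.update g i y n := fun n hn => by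
      have hni : n ≠ i := by omega
      rw [Function.update_of_ne hni, Function.update_of_ne hni]
    have h := hO _ (update_mem_boxWindow hg i hx) _ (update_mem_boxWindow hg i hy) U X (i + 1) (by omega) hagree
    rwa [show C.scale X - (i + 1) = a by omega] at h
  -- Landau with the step `h = (γ/2)·ρ^a`
  have hρa : 0 < ρ ^ a := pow_pos hρ0 a
  have hρa1 : ρ ^ a ≤ 1 := pow_le_one₀ hρ0.le hρ1
  have hh0 : 0 < γ / 2 * ρ ^ a := by positivity
  have hhγ : γ / 2 * ρ ^ a ≤ γ / 2 := by nlinarith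
  have hMw : 0 ≤ M * μ ^ a * w := by positivity
  have hτ0 : 0 ≤ τ := by
    by_contra hneg
    have : τ * ρ < 0 := mul_neg_of_neg_of_pos (not_le.mp hneg) hρ0
    linarith
  have hderiv : ∀ x ∈ Ioc (0 : ℝ) γ, |f' x| ≤ w * ((2 * C₀ / γ + M * γ / 2) * τ ^ a) := by
    intro x hx
    have hL := abs_deriv_le_of_osc hf' hLip hMw hosc hh0 hhγ hx
    have hθa : θ ^ a ≤ τ ^ a * ρ ^ a := by
      rw [← mul_pow]
      exact pow_le_pow_left₀ hθ0 hθτρ a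
    have hμa : μ ^ a * ρ ^ a ≤ τ ^ a := by
      rw [← mul_pow]
      exact pow_le_pow_left₀ (mul_nonneg hμ hρ0.le) hμρτ a
    have hq : C₀ * θ ^ a * w / (γ / 2 * ρ ^ a) ≤ w * (2 * C₀ / γ * τ ^ a) := by
      rw [div_le_iff₀ hh0]
      calc C₀ * θ ^ a * w ≤ C₀ * (τ ^ a * ρ ^ a) * w :=
            mul_le_mul_of_nonneg_right (mul_le_mul_of_nonneg_left hθa hC₀) hw0.le
        _ = w * (2 * C₀ / γ * τ ^ a) * (γ / 2 * ρ ^ a) := by field_simp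
    have hq2 : M * μ ^ a * w * (γ / 2 * ρ ^ a) ≤ M * w * (γ / 2 * τ ^ a) := by
      have := mul_le_mul_of_nonneg_left hμa (by positivity : 0 ≤ M * w * (γ / 2))
      calc M * μ ^ a * w * (γ / 2 * ρ ^ a) = M * w * (γ / 2) * (μ ^ a * ρ ^ a) := by ring
        _ ≤ M * w * (γ / 2) * τ ^ a := this
        _ = M * w * (γ / 2 * τ ^ a) := by ring
    calc |f' x| ≤ C₀ * θ ^ a * w / (γ / 2 * ρ ^ a) + M * μ ^ a * w * (γ / 2 * ρ ^ a) := hL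
      _ ≤ w * (2 * C₀ / γ * τ ^ a) + M * w * (γ / 2 * τ ^ a) := add_le_add hq hq2
      _ = w * ((2 * C₀ / γ + M * γ / 2) * τ ^ a) := by ring
  have hgi : g i ∈ Ioc (0 : ℝ) γ := hg i
  have key := abs_sub_le_of_deriv_bound hf' hderiv hgi ht
  rwa [Function.update_eq_self] at key

/-- **COORDINATEWISE FADING LIPSCHITZ CONSTANTS — ONE UNIFORM REGULARITY CONSTANT** (`μ = 1`, Landau step ratio `ρ = τ`): (O) with `C₀, θ`
and (R) with constant `M·e^{−κd(X)}` give the cost `e^{−κd(X)}·(2C₀∕γ + Mγ∕2)·τ^{scale X − 1 − i}·|t − g_i|` for every rate `τ ∈ ]0, 1]` with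
`θ ≤ τ²` (rate `√θ` at best). [folklore] -/
theorem abs_sub_update_le_of_osc_smooth {γ κ C₀ θ M τ : ℝ}
    (hO : ∀ g ∈ Window γ, ∀ g' ∈ Window γ, ∀ (U : Bg) (X : C.Dom) (a : ℕ), a ≤ C.scale X →
      (∀ n, a ≤ n → g n = g' n) → |E g U X - E g' U X| ≤ C₀ * θ ^ (C.scale X - a) * Real.exp (-(κ * C.d X)))
    (hR : ∀ g ∈ Window γ, ∀ (U : Bg) (X : C.Dom) (i : ℕ), i < C.scale X → ∃ f' : ℝ → ℝ,
      (∀ t ∈ Icc (0 : ℝ) γ, HasDerivWithinAt (fun t : ℝ => E (Function.update g i t) U X) (f' t) (Icc (0 : ℝ) γ) t) ∧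
      ∀ s ∈ Icc (0 : ℝ) γ, ∀ t ∈ Icc (0 : ℝ) γ, |f' s - f' t| ≤ M * Real.exp (-(κ * C.d X)) * |s - t|)
    (hC₀ : 0 ≤ C₀) (hθ0 : 0 ≤ θ) (hM : 0 ≤ M) (hγ : 0 < γ) (hτ0 : 0 < τ) (hτ1 : τ ≤ 1) (hθτ : θ ≤ τ ^ 2)
    {g : ℕ → ℝ} (hg : g ∈ Window γ) (U : Bg) (X : C.Dom) {i : ℕ} (hi : i < C.scale X) {t : ℝ}
    (ht : t ∈ Ioc (0 : ℝ) γ) :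
    |E (Function.update g i t) U X - E g U X| ≤
      Real.exp (-(κ * C.d X)) * ((2 * C₀ / γ + M * γ / 2) * τ ^ (C.scale X - 1 - i)) * |t - g i| := by
  refine abs_sub_update_le_of_osc_growingSmooth (μ := 1) (ρ := τ) hO (fun g hg U X i hi => ?_) hC₀ hθ0 hM zero_le_one hγ
    hτ0 hτ1 (by rw [← sq]; exact hθτ) (by rw [one_mul]) hg U X hi ht
  obtain ⟨f', hf', hLip⟩ := hR g hg U X i hi
  exact ⟨f', hf', fun s hs t ht => by simpa only [one_pow, mul_one] using hLip s hs t ht⟩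

/-! ## §2 The coordinatewise shape `CoordLipschitzOn` of `T4CouplingAnalyticity` with FADING moduli; `NE9` by its telescoping -/

/-- **(O) + (R_μ) ⇒ `CoordLipschitzOn ]0, γ]` WITH GEOMETRICALLY FADING MODULI** `Λ₁ k i = C₉·τ^{k−i}`, `C₉ = (2C₀∕γ + Mγ∕2)∕τ`: pv10's
typed missing inequality (W5) (coordinatewise Lipschitz dependence on each running coupling, uniformly down to the vertex) holds with moduli
that DECAY in the age — §1 between two updated values of the same coupling, and `C₁·τ^{j−1−i} = (C₁∕τ)·τ^{j−i}` for `i < j`. [folklore] -/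
theorem coordLipschitzOn_of_osc_growingSmooth {γ κ C₀ θ M μ ρ τ : ℝ}
    (hO : ∀ g ∈ Window γ, ∀ g' ∈ Window γ, ∀ (U : Bg) (X : C.Dom) (a : ℕ), a ≤ C.scale X →
      (∀ n, a ≤ n → g n = g' n) → |E g U X - E g' U X| ≤ C₀ * θ ^ (C.scale X - a) * Real.exp (-(κ * C.d X)))
    (hR : ∀ g ∈ Window γ, ∀ (U : Bg) (X : C.Dom) (i : ℕ), i < C.scale X → ∃ f' : ℝ → ℝ,
      (∀ t ∈ Icc (0 : ℝ) γ, HasDerivWithinAt (fun t : ℝ => E (Function.update g i t) U X) (f' t) (Icc (0 : ℝ) γ) t) ∧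
      ∀ s ∈ Icc (0 : ℝ) γ, ∀ t ∈ Icc (0 : ℝ) γ,
        |f' s - f' t| ≤ M * μ ^ (C.scale X - 1 - i) * Real.exp (-(κ * C.d X)) * |s - t|)
    (hC₀ : 0 ≤ C₀) (hθ0 : 0 ≤ θ) (hM : 0 ≤ M) (hμ : 0 ≤ μ) (hγ : 0 < γ) (hρ0 : 0 < ρ) (hρ1 : ρ ≤ 1)
    (hθτρ : θ ≤ τ * ρ) (hμρτ : μ * ρ ≤ τ) (hτ0 : 0 < τ) :
    CoordLipschitzOn (Ioc (0 : ℝ) γ) E κ (fun k i => (2 * C₀ / γ + M * γ / 2) / τ * τ ^ (k - i)) := by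
  intro U X g hg i hi s hs s' hs'
  -- reduce to "update vs original" at the history `update g i s'`, whose `i`-th coupling is `s'`
  have hg' : Function.update g i s' ∈ Window γ := update_mem_boxWindow hg i hs'
  have key := abs_sub_update_le_of_osc_growingSmooth hO hR hC₀ hθ0 hM hμ hγ hρ0 hρ1 hθτρ hμρτ hg' U X hi hs
  rw [Function.update_idem, Function.update_self] at key
  -- `C₁·τ^{j−1−i} = (C₁/τ)·τ^{j−i}` since `i < j`
  have hpow : (2 * C₀ / γ + M * γ / 2) / τ * τ ^ (C.scale X - i)
      = (2 * C₀ / γ + M * γ / 2) * τ ^ (C.scale X - 1 - i) := by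
    rw [show C.scale X - i = (C.scale X - 1 - i) + 1 by omega, pow_succ]
    field_simp
  show |E (Function.update g i s) U X - E (Function.update g i s') U X| ≤
    Real.exp (-(κ * C.d X)) * ((2 * C₀ / γ + M * γ / 2) / τ * τ ^ (C.scale X - i) * |s - s'|)
  rw [hpow, ← mul_assoc]
  exact key

/-! ## §3 HEADLINE: node N22's statement of record from (P) + (O) + (R) -/

/-- The geometric family `Λ k i = C₉·τ^{k−i}` IS a fading-memory family for any `C₉ ≥ 0`, `τ ≥ 0` (the second conjunct of node N22 for
the derived moduli is bookkeeping). [folklore] -/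
theorem fadingMemory_geometric {C₉ τ : ℝ} (hC : 0 ≤ C₉) (hτ : 0 ≤ τ) :
    FadingMemory C₉ τ (fun k i => C₉ * τ ^ (k - i)) :=
  fun _ _ _ => ⟨mul_nonneg hC (pow_nonneg hτ _), le_rfl⟩

/-- **HEADLINE, GROWING REGULARITY CONSTANTS — NODE N22 FROM (P) + (O) + (R_μ).**  On the abstract output carriers, (P)
`PrefixDependenceOn E (Window γ)` ([Balaban1987RG1] p. 256, in words), (O) oscillation fading with `C₀ ≥ 0`, rate `θ ≥ 0` (= tower-NE5, §4;
NOT PRINTED) and (R_μ) C^{1,1} regularity of the young-coupling sections on `[0, γ]` with constants `M·μ^{age−1}·e^{−κd(X)}` (`M, μ ≥ 0`;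
printed TYPE for the last coupling, p. 263) give, for every step ratio `ρ ∈ ]0, 1]` and rate `τ > 0` with `θ ≤ τρ`, `μρ ≤ τ`:
**`NE9 E (Window γ) κ Λ₁ ∧ FadingMemory C₉ τ Λ₁`**, `Λ₁ k i = C₉·τ^{k−i}`, `C₉ = (2C₀∕γ + Mγ∕2)∕τ` — node N22's statement of record BY NAME;
the first conjunct by pv10's telescoping `ne9_of_coordLipschitz`, the second by `fadingMemory_geometric`.  FADING (`τ < 1`) is available iff
`θμ < 1`: the regularity constants may grow at any rate below `θ⁻¹` — the E-side smallness is relaxed from the recursion's `ω + c < 1`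
(clause N2 of the gaps census) to `μ < θ⁻¹`. [folklore] -/
theorem ne9_and_fadingMemory_of_osc_growingSmooth {γ κ C₀ θ M μ ρ τ : ℝ} (hP : PrefixDependenceOn E (Window γ))
    (hO : ∀ g ∈ Window γ, ∀ g' ∈ Window γ, ∀ (U : Bg) (X : C.Dom) (a : ℕ), a ≤ C.scale X →
      (∀ n, a ≤ n → g n = g' n) → |E g U X - E g' U X| ≤ C₀ * θ ^ (C.scale X - a) * Real.exp (-(κ * C.d X)))
    (hR : ∀ g ∈ Window γ, ∀ (U : Bg) (X : C.Dom) (i : ℕ), i < C.scale X → ∃ f' : ℝ → ℝ,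
      (∀ t ∈ Icc (0 : ℝ) γ, HasDerivWithinAt (fun t : ℝ => E (Function.update g i t) U X) (f' t) (Icc (0 : ℝ) γ) t) ∧
      ∀ s ∈ Icc (0 : ℝ) γ, ∀ t ∈ Icc (0 : ℝ) γ,
        |f' s - f' t| ≤ M * μ ^ (C.scale X - 1 - i) * Real.exp (-(κ * C.d X)) * |s - t|)
    (hC₀ : 0 ≤ C₀) (hθ0 : 0 ≤ θ) (hM : 0 ≤ M) (hμ : 0 ≤ μ) (hγ : 0 < γ) (hρ0 : 0 < ρ) (hρ1 : ρ ≤ 1)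
    (hθτρ : θ ≤ τ * ρ) (hμρτ : μ * ρ ≤ τ) (hτ0 : 0 < τ) :
    NE9 E (Window γ) κ (fun k i => (2 * C₀ / γ + M * γ / 2) / τ * τ ^ (k - i)) ∧
      FadingMemory ((2 * C₀ / γ + M * γ / 2) / τ) τ (fun k i => (2 * C₀ / γ + M * γ / 2) / τ * τ ^ (k - i)) := by
  have hC₁ : 0 ≤ 2 * C₀ / γ + M * γ / 2 := by positivity
  exact ⟨ne9_of_coordLipschitz hP
      (coordLipschitzOn_of_osc_growingSmooth hO hR hC₀ hθ0 hM hμ hγ hρ0 hρ1 hθτρ hμρτ hτ0),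
    fadingMemory_geometric (div_nonneg hC₁ hτ0.le) hτ0.le⟩

/-- **HEADLINE — NODE N22 (NE9 ∧ FADING MEMORY) FROM OSCILLATION FADING + ONE REGULARITY CONSTANT.**  On the abstract output carriers, for
a functional `E` with (P) `PrefixDependenceOn E (Window γ)` (printed in words, [Balaban1987RG1] p. 256), (O) OSCILLATION FADING with
constant `C₀ ≥ 0` and rate `θ ≥ 0` (= tower-NE5, node N18 at every pair of run lengths, §4 ∕ `MemoryFromRate.osc_le_of_towerRate`;
NOT PRINTED), and (R) COORDINATEWISE C^{1,1} regularity with ONE constant `M·e^{−κd(X)}`, `M ≥ 0`, on `[0, γ]`, `γ > 0` (printed TYPE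
for the last coupling, p. 263; unprinted for the older ones): for every rate `τ ∈ ]0, 1]` with `θ ≤ τ²`, the moduli
`Λ₁ k i := C₉·τ^{k−i}`, `C₉ = (2C₀∕γ + Mγ∕2)∕τ`, satisfy **`NE9 E (Window γ) κ Λ₁ ∧ FadingMemory C₉ τ Λ₁`** — the node's statement of
record BY NAME with the DECAY of the moduli derived, not assumed (rate `√θ` at best under C^{1,1}).  Hypothesis shapes only;
instance on Bałaban's `E^{(j)}` 0∕1. [folklore] -/
theorem ne9_and_fadingMemory_of_osc_smooth {γ κ C₀ θ M τ : ℝ} (hP : PrefixDependenceOn E (Window γ))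
    (hO : ∀ g ∈ Window γ, ∀ g' ∈ Window γ, ∀ (U : Bg) (X : C.Dom) (a : ℕ), a ≤ C.scale X →
      (∀ n, a ≤ n → g n = g' n) → |E g U X - E g' U X| ≤ C₀ * θ ^ (C.scale X - a) * Real.exp (-(κ * C.d X)))
    (hR : ∀ g ∈ Window γ, ∀ (U : Bg) (X : C.Dom) (i : ℕ), i < C.scale X → ∃ f' : ℝ → ℝ,
      (∀ t ∈ Icc (0 : ℝ) γ, HasDerivWithinAt (fun t : ℝ => E (Function.update g i t) U X) (f' t) (Icc (0 : ℝ) γ) t) ∧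
      ∀ s ∈ Icc (0 : ℝ) γ, ∀ t ∈ Icc (0 : ℝ) γ, |f' s - f' t| ≤ M * Real.exp (-(κ * C.d X)) * |s - t|)
    (hC₀ : 0 ≤ C₀) (hθ0 : 0 ≤ θ) (hM : 0 ≤ M) (hγ : 0 < γ) (hτ0 : 0 < τ) (hτ1 : τ ≤ 1) (hθτ : θ ≤ τ ^ 2) :
    NE9 E (Window γ) κ (fun k i => (2 * C₀ / γ + M * γ / 2) / τ * τ ^ (k - i)) ∧
      FadingMemory ((2 * C₀ / γ + M * γ / 2) / τ) τ (fun k i => (2 * C₀ / γ + M * γ / 2) / τ * τ ^ (k - i)) := by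
  refine ne9_and_fadingMemory_of_osc_growingSmooth (μ := 1) (ρ := τ) hP hO (fun g hg U X i hi => ?_) hC₀ hθ0 hM zero_le_one
    hγ hτ0 hτ1 (by rw [← sq]; exact hθτ) (by rw [one_mul]) hτ0
  obtain ⟨f', hf', hLip⟩ := hR g hg U X i hi
  exact ⟨f', hf', fun s hs t ht => by simpa only [one_pow, mul_one] using hLip s hs t ht⟩

/-! ## §3b The C² form of (R): a uniform second-derivative bound on the sections -/

/-- (R) FROM A SECOND-DERIVATIVE BOUND: if the section has derivatives `f′` within `[0, γ]` and `f′` has derivative `f″` within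
`[0, γ]` with `|f″| ≤ M'` there, then `f′` is `M'`-Lipschitz on `[0, γ]` (mean value inequality) — the form in which a Cauchy estimate
on a complex neighbourhood of `[0, γ]` (the printed *"(or analytic)"* branch, [Balaban1987RG1] p. 263 ∕ p. 266) delivers (R). [folklore] -/
theorem lipDeriv_of_derivTwo_bound {f' f'' : ℝ → ℝ} {γ M' : ℝ}
    (hd2 : ∀ x ∈ Icc (0 : ℝ) γ, HasDerivWithinAt f' (f'' x) (Icc (0 : ℝ) γ) x)
    (hb : ∀ x ∈ Icc (0 : ℝ) γ, |f'' x| ≤ M') {s t : ℝ} (hs : s ∈ Icc (0 : ℝ) γ) (ht : t ∈ Icc (0 : ℝ) γ) :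
    |f' s - f' t| ≤ M' * |s - t| := by
  have key := (convex_Icc (0 : ℝ) γ).norm_image_sub_le_of_norm_hasDerivWithin_le hd2
    (fun x hx => by simpa [Real.norm_eq_abs] using hb x hx) ht hs
  simpa [Real.norm_eq_abs] using key

/-- **NODE N22 FROM OSCILLATION FADING + A SECOND-DERIVATIVE BOUND** (C² sections, `|∂²_i E| ≤ M·e^{−κd(X)}` on `[0, γ]`): the headline
with (R) supplied by `lipDeriv_of_derivTwo_bound`. [folklore] -/
theorem ne9_and_fadingMemory_of_osc_derivTwo {γ κ C₀ θ M τ : ℝ} (hP : PrefixDependenceOn E (Window γ))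
    (hO : ∀ g ∈ Window γ, ∀ g' ∈ Window γ, ∀ (U : Bg) (X : C.Dom) (a : ℕ), a ≤ C.scale X →
      (∀ n, a ≤ n → g n = g' n) → |E g U X - E g' U X| ≤ C₀ * θ ^ (C.scale X - a) * Real.exp (-(κ * C.d X)))
    (hR2 : ∀ g ∈ Window γ, ∀ (U : Bg) (X : C.Dom) (i : ℕ), i < C.scale X → ∃ f' f'' : ℝ → ℝ,
      (∀ t ∈ Icc (0 : ℝ) γ, HasDerivWithinAt (fun t : ℝ => E (Function.update g i t) U X) (f' t) (Icc (0 : ℝ) γ) t) ∧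
      (∀ t ∈ Icc (0 : ℝ) γ, HasDerivWithinAt f' (f'' t) (Icc (0 : ℝ) γ) t) ∧
      ∀ t ∈ Icc (0 : ℝ) γ, |f'' t| ≤ M * Real.exp (-(κ * C.d X)))
    (hC₀ : 0 ≤ C₀) (hθ0 : 0 ≤ θ) (hM : 0 ≤ M) (hγ : 0 < γ) (hτ0 : 0 < τ) (hτ1 : τ ≤ 1) (hθτ : θ ≤ τ ^ 2) :
    NE9 E (Window γ) κ (fun k i => (2 * C₀ / γ + M * γ / 2) / τ * τ ^ (k - i)) ∧
      FadingMemory ((2 * C₀ / γ + M * γ / 2) / τ) τ (fun k i => (2 * C₀ / γ + M * γ / 2) / τ * τ ^ (k - i)) := by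
  refine ne9_and_fadingMemory_of_osc_smooth hP hO (fun g hg U X i hi => ?_) hC₀ hθ0 hM hγ hτ0 hτ1 hθτ
  obtain ⟨f', f'', hf', hf'', hb⟩ := hR2 g hg U X i hi
  exact ⟨f', hf', fun s hs t ht => lipDeriv_of_derivTwo_bound hf'' hb hs ht⟩

end Abstract

/-! ## §4 The in-edge N18 BY NAME: tower-NE5 on ne9's tower of carriers gives (O) at every level, hence node N22 at every level -/

section Tower

variable (T : TowerData) {E : ℕ → (ℕ → ℝ) → T.B → T.Dom → ℝ}

/-- **TOWER-NE5 ⇒ OSCILLATION FADING (O) AT EVERY LEVEL.**  On the tower of carriers, `TowerNE5 T E γ κ θ C₅` (`T4OutputRate.NE5` BY NAME at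
every pair of consecutive run lengths, run B's unpaired bare coupling as a parameter — node N18 read along the tower; `C₅ ≥ 0`, `0 ≤ θ < 1`)
gives, for the level-`k` functional `E k` on the level carriers `T.level k` (scale index `k − r X`): two admissible histories agreeing at every
index `≥ a`, `a ≤ k − r X`, have terms within `(2C₅∕(1−θ))·θ^{(k − r X) − a}·e^{−κd(X)}` — peel the `a` oldest couplings through the
descended backgrounds (`extendTower_rate` on the section of the tower at `(k, U, X)`, then `MemoryFromRate.osc_le_of_towerRate`). [folklore] -/
theorem oscFading_of_towerNE5 {γ κ θ C₅ : ℝ} (hC : 0 ≤ C₅) (hθ0 : 0 ≤ θ) (hθ1 : θ < 1) (h5 : TowerNE5 T E γ κ θ C₅) (k : ℕ) :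
    ∀ g ∈ Window γ, ∀ g' ∈ Window γ, ∀ (U : (T.level k).BgA) (X : (T.level k).Dom) (a : ℕ), a ≤ (T.level k).scale X →
      (∀ n, a ≤ n → g n = g' n) →
      |E k g U X - E k g' U X| ≤ 2 * C₅ / (1 - θ) * θ ^ ((T.level k).scale X - a) * Real.exp (-(κ * (T.level k).d X)) := by
  intro g hg g' hg' U X a ha hagree
  change a ≤ k - T.r X at ha
  show |E k g U X - E k g' U X| ≤ 2 * C₅ / (1 - θ) * θ ^ (k - T.r X - a) * Real.exp (-(κ * T.d X))
  rcases Nat.eq_zero_or_pos a with ha0 | ha0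
  · -- nothing to peel: the histories coincide
    subst ha0
    have hgg : g = g' := funext fun n => hagree n (Nat.zero_le n)
    rw [hgg, sub_self, abs_zero]
    have h1θ : 0 < 1 - θ := by linarith
    positivity
  · -- `a ≥ 1`, so `r X < k`: the section of the tower at `(k, U, X)` below the top level `m₀ = k − r X`
    have hX : T.r X ≤ k := by omega
    set m₀ := k - T.r X with hm₀
    set F₀ : ℕ → (ℕ → ℝ) → ℝ :=
      fun m g => Real.exp (κ * T.d X) * E (T.r X + m) g (T.descend k U (T.r X + m)) X with hF₀
    have hpos : 0 < Real.exp (κ * T.d X) := Real.exp_pos _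
    have hT : ∀ m, ∀ g ∈ Window γ,
        |extendTower m₀ F₀ (m + 1) g - extendTower m₀ F₀ m (fun i => g (i + 1))| ≤ C₅ * θ ^ m := by
      refine extendTower_rate hC hθ0 fun m hm g hg => ?_
      have hn : T.r X + m < k := by omega
      have hrate := rate_of_towerNE5 T h5 (T.r X + m) hg (T.descend k U (T.r X + m + 1)) X
      rw [T.tr_descend hn, Nat.add_sub_cancel_left] at hrate
      have e : F₀ (m + 1) g - F₀ m (fun i => g (i + 1)) = Real.exp (κ * T.d X) *
          (E (T.r X + m + 1) g (T.descend k U (T.r X + m + 1)) X -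
            E (T.r X + m) (fun i => g (i + 1)) (T.descend k U (T.r X + m)) X) := by
        rw [hF₀, ← mul_sub]
        rfl
      rw [e, abs_mul, abs_of_pos hpos]
      calc Real.exp (κ * T.d X) * |E (T.r X + m + 1) g (T.descend k U (T.r X + m + 1)) X -
              E (T.r X + m) (fun i => g (i + 1)) (T.descend k U (T.r X + m)) X|
          ≤ Real.exp (κ * T.d X) * (C₅ * θ ^ m * Real.exp (-(κ * T.d X))) :=
            mul_le_mul_of_nonneg_left hrate hpos.le
        _ = C₅ * θ ^ m := by rw [Real.exp_neg]; field_simp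
    -- peel the `a` oldest couplings at the top level `m₀ = (m₀ − a) + a`
    have hosc := osc_le_of_towerRate (F := extendTower m₀ F₀) hC hθ0 hθ1 (fun g hg => shift_mem_window hg) hT
      (a := a) (m := m₀ - a) hg hg' hagree
    rw [Nat.sub_add_cancel ha, extendTower_of_le F₀ le_rfl, extendTower_of_le F₀ le_rfl] at hosc
    have etop : ∀ h : ℕ → ℝ, F₀ m₀ h = Real.exp (κ * T.d X) * E k h U X := fun h => by
      simp only [hF₀]
      rw [show T.r X + m₀ = k by omega, T.descend_top]
    rw [etop, etop, ← mul_sub, abs_mul, abs_of_pos hpos] at hosc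
    -- divide by `e^{κd(X)}`
    have h1θ : 0 < 1 - θ := by linarith
    rw [Real.exp_neg]
    have key : |E k g U X - E k g' U X| ≤ 2 * C₅ * θ ^ (m₀ - a) / (1 - θ) / Real.exp (κ * T.d X) := by
      rw [le_div_iff₀ hpos, mul_comm]
      exact hosc
    calc |E k g U X - E k g' U X| ≤ 2 * C₅ * θ ^ (m₀ - a) / (1 - θ) / Real.exp (κ * T.d X) := key
      _ = 2 * C₅ / (1 - θ) * θ ^ (m₀ - a) * (Real.exp (κ * T.d X))⁻¹ := by ring

/-- **NODE N22 AT EVERY LEVEL OF THE TOWER FROM NODE N18's TOWER STATEMENT + REGULARITY.**  `TowerNE5 T E γ κ θ C₅` (node N18 BY NAME along the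
tower; `C₅ ≥ 0`, `0 ≤ θ < 1`), prefix dependence (P) and C^{1,1} regularity (R) (constant `M·e^{−κd(X)}`, `M ≥ 0`, on `[0, γ]`, `γ > 0`) of every
level functional `E k` on its level carriers, and a rate `τ ∈ ]0, 1]` with `θ ≤ τ²` give **`TowerNE9 T E γ κ Λ₁ ∧ FadingMemory C₉ τ Λ₁`** —
`T4OutputRate.NE9` BY NAME at every level with the fading moduli `Λ₁ k i = C₉·τ^{k−i}`, `C₉ = (2·(2C₅∕(1−θ))∕γ + Mγ∕2)∕τ` (§3 with §4's
`C₀ = 2C₅∕(1−θ)`). [folklore] -/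
theorem towerNE9_fadingMemory_of_towerNE5_smooth {γ κ θ C₅ M τ : ℝ} (hC : 0 ≤ C₅) (hθ0 : 0 ≤ θ) (hθ1 : θ < 1)
    (h5 : TowerNE5 T E γ κ θ C₅) (hP : ∀ k, PrefixDependenceOn (C := T.level k) (E k) (Window γ))
    (hR : ∀ k, ∀ g ∈ Window γ, ∀ (U : (T.level k).BgA) (X : (T.level k).Dom) (i : ℕ), i < (T.level k).scale X → ∃ f' : ℝ → ℝ,
      (∀ t ∈ Icc (0 : ℝ) γ, HasDerivWithinAt (fun t : ℝ => E k (Function.update g i t) U X) (f' t) (Icc (0 : ℝ) γ) t) ∧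
      ∀ s ∈ Icc (0 : ℝ) γ, ∀ t ∈ Icc (0 : ℝ) γ, |f' s - f' t| ≤ M * Real.exp (-(κ * (T.level k).d X)) * |s - t|)
    (hM : 0 ≤ M) (hγ : 0 < γ) (hτ0 : 0 < τ) (hτ1 : τ ≤ 1) (hθτ : θ ≤ τ ^ 2) :
    TowerNE9 T E γ κ (fun k i => (2 * (2 * C₅ / (1 - θ)) / γ + M * γ / 2) / τ * τ ^ (k - i)) ∧
      FadingMemory ((2 * (2 * C₅ / (1 - θ)) / γ + M * γ / 2) / τ) τ
        (fun k i => (2 * (2 * C₅ / (1 - θ)) / γ + M * γ / 2) / τ * τ ^ (k - i)) := by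
  have h1θ : 0 < 1 - θ := by linarith
  have hC₀ : 0 ≤ 2 * C₅ / (1 - θ) := by positivity
  refine ⟨fun k => ?_, ?_⟩
  · exact (ne9_and_fadingMemory_of_osc_smooth (C := T.level k) (hP k) (oscFading_of_towerNE5 T hC hθ0 hθ1 h5 k) (hR k)
      hC₀ hθ0 hM hγ hτ0 hτ1 hθτ).1
  · exact fadingMemory_geometric (div_nonneg (by positivity) hτ0.le) hτ0.le

end Tower

end Summit.QuantumFields.YangMills.BalabanUVNodes.N22Knit

end
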